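import Literature.MathematicalPhysics.QuantumFieldTheory.Balaban1983to89.B9Eq3115KnitLetterY
import Literature.MathematicalPhysics.QuantumFieldTheory.Balaban1983to89.Node00.OpsYC2OfRecord
import Literature.MathematicalPhysics.QuantumFieldTheory.Balaban1983to89.B9Thm311AdjointPairs
import Literature.MathematicalPhysics.QuantumFieldTheory.Balaban1983to89.Node00.OpsYQOnto
import Literature.MathematicalPhysics.QuantumFieldTheory.Balaban1983to89.B9Eq3132Ineq2142Covariant
import Literature.MathematicalPhysics.QuantumFieldTheory.Balaban1983to89.B9Eq3115KnitLetterYLaws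
import Literature.MathematicalPhysics.QuantumFieldTheory.Balaban1983to89.B9Eq3124HZKnitPairReg335Y

/-!
# Balaban [B9], (3.12)–(3.16) p. 393, (3.115) p. 418, (3.123)–(3.126) p. 420; [5] (11) p. 19, (15)–(23) pp. 19–21 — NODE 00, THE AVERAGING
# LETTER AS A PARAMETER: the type `QLetterY` of «an averaging operator `Q(U)`», its LAW BUNDLE `QLawsY` ((L1)–(L8), every-`U` laws vs REGIME laws
# keyed to the member's LOCAL class (3.35)), the GENERIC ADJOINT `adjTrY` for the trace pairings ((L3) for free), and the two instances of record
# `qYOfRecord` (today's straight-contour `Q(U)` of (3.12), `parBY`) and `qKnitOfRecord` (the knit ∕ composite averaging `Q_k(U)` of [5] (15), dag-n06-l's `QknitY`)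

T. Bałaban, *Propagators for lattice gauge theories in a background field*, Commun. Math. Phys. **99** (1985) 389–434
[`Balaban1985BackgroundPropagators`, "B9"]; [5] = T. Bałaban, *Averaging operations for lattice gauge theories*, Commun. Math. Phys. **98** (1985)
17–51 [`Balaban1985Averaging`].

statement-level skeleton of published theorems with citation tags; proofs where landed; nothing here is a claim about the Yang–Mills mass gap

THE PRINTED LOCI.  (3.12)–(3.14) p. 393: the covariant averaging `Q(U)` of bond functions to coarse bonds, an average of parallel transports along
contours with nonnegative weights of total mass one; (3.13): `Q*(U)` its adjoint for the scalar products of p. 393; (3.15): their sizes; (3.32)–(3.34)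
pp. 395–396: gauge covariance; p. 391: the letters act on hermitian-valued functions; (3.115) p. 418: «Q_U D_U λ = 0 for λ satisfying Q′λ = 0»
— the identity that removes the mixed `H`-terms in (3.121)–(3.125) p. 420 and makes `Q(U) D_U G′(U)R(U) = 0`; (3.123)–(3.126) p. 420: `Q G Q*` is
invertible ON THE RANGE of `Q`, `H = G Q*(Q G Q*)⁻¹`; [5] (11) p. 19: «the averaging preserves gauge transformations»; [5] (15)–(23) pp. 19–21: the
averaging `Ū = exp[iQ_k(U)…]`-type composite (knit) operation whose linearisation at `U` is `Q_k(U)`, which at `U = 1` is the straight-contour `Q`.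

WHY THIS FILE (pub-ymgap N06, O5 ∕ R2 «re-pin of the averaging letter», director-ym ruling №375 (2026-08-30): R2-A GO).  The N06 certificate of record
displays, at its rows 20–21, the (3.115)-nullity `hZ : Q(U) D_U G′(U) R(U) = 0` for the TYPED pair (`QY x (parBY x)`, `parSymY x`) over the member's
regularity class (3.35).  LOCATED FACT (dag-n06-l, design memo `R2-REPIN-DESIGN.md` §1): for that typed pair the display is inhabitable only at `U = 1`
— print's `Q` in (3.115) is the LINEARISATION OF THE COMPOSITE (knit) AVERAGING of [5], which coincides with the straight-contour `QY parBY` at flat `U`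
and differs from it at curved `U`; the knit letter `QknitY` (✓ `B9Eq3115KnitLetterY`) does satisfy (3.115) (`QknitY_gradY_GpPhysY_RY_parKnitY`, in the
(52)-currency of [5]; in the certificate's LOCAL (3.35) currency by dag-n06-l's `…_of_reg335P`).  The cure adopted (R2-A) is ADDITIVE: a v10 record chain
in which the averaging letter is a PARAMETER `𝔮 : QFamY N θ M⋆` carrying a LAW BUNDLE, instantiated at `qYOfRecord` (every v ≤ 9 face `rfl`) and at
`qKnitOfRecord` (the certificate's re-keyed rows 20–21).  THIS FILE is step (2) of that chain: the types, the laws, the generic adjoint, the two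
instances and the laws they provably satisfy today, BY NAME.  Nothing of v ≤ 9 is edited.

THE LAWS (§2; `𝔮 : QLetterY 𝔸 i := CfgY 𝔸 i → ((FBondY i → 𝔸) →ₗ[ℂ] (IBondY i → 𝔸))`, regime `𝓡 : CfgY 𝔸 i → Prop`):
* EVERY-`U` laws — (L1) `IsFlatQ 𝔮`: `𝔮 1 = Q♯` (the flat averaging `liftMatY (qK i)`); (L2) `IsLocalQ D 𝔮`: `(𝔮 U a)(ι)` depends on `U` and `a` only
  through the bonds of a dependency set `D ι`; (L5) `IsCovCornerQ 𝔮`: [5] (11) ∕ (3.32) with the CORNER key `gSrcCornerY` (director Q3: corner keying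
  uniformly in v10) for gauge functions of unitary type `U1`;
* REGIME laws (quantified over `𝓡`, which the record instantiates at the member's LOCAL class `regQY G i c α₀ := (bg9KP 𝔸 G i).Reg335 c α₀` — NEVER at
  the global small-field condition (52) of [5] at scale `k`, which (3.35) does not supply (dag-n06-l's currency point)) — (L3) `IsAdjOnQ 𝓡 𝔮 𝔮⋆`:
  `𝔮⋆ U` is the adjoint of `𝔮 U` for the trace pairings (`B9Thm311ReadingCoords.IsAdjTr` at unit weights); (L4) `IsRealOnQ 𝓡 𝔮`: `𝔮 U` maps
  hermitian-valued to hermitian-valued (`IsRealOpY`); (L6) `IsOntoOnQ 𝓡 𝔮`: `𝔮 U` is onto (what makes `Q G Q*` invertible on the range, (3.123));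
  (L7) `IsBddOnQ 𝓡 𝔮 K`: `‖(𝔮 U a)(ι)‖ ≤ K‖a‖` ((3.15)); (L8) `IsNullOnQ 𝓡 𝔮 parS`: (3.115) in the certificate's shape
  `𝔮 U ∘ D_U ∘ G′_phys(U) ∘ R(U) = 0` at the site transporter `parS`;
* the conjunction `QLawsY 𝓡 D 𝔮 𝔮⋆ parS K` for a one-binder display.
THE GENERIC ADJOINT (§1): for ANY `ℂ`-linear `T : (X → M_N(ℂ)) → (Y → M_N(ℂ))`, `adjTrY T` — the adjoint for the sesquilinear trace pairing
`Σ tr(Φᴴ Ψ)`, given entrywise by `(adjTrY T Ψ)(x)_{ab} = Σ_y tr((T δ_x E_{ab})(y)ᴴ Ψ(y))` — IS an `IsAdjTr`-partner of `T` at unit weights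
(`isAdjTr_adjTrY`, no hypothesis), and is real when `T` is (`IsRealOpY.adjTrY`); so (L3) holds for every letter with `𝔮⋆ := adjTrY ∘ 𝔮`
(`isAdjOnQ_adjTrY`).
THE INSTANCES (§3 at a k-level index `i`, §4 memberwise): `QY i (parBY i)` satisfies (L1) (`QY_one`), (L3) with partner `QsY i (parBY i)` on `G`-valued
configurations, `G ≤ U(N)` (`B9Thm311AdjointPairs.isAdjTr_QY_QsY_parBY`), (L4) there (`QY_isRealOpY`), (L6) at every `U` (`QY_surjective`), (L7) with
`K = 1` for `G ≤ U1` (`B9Eq3132Ineq2142Covariant.norm_QY_apply_le`); its covariance of record is CENTRE-keyed (`QY_cov`, `gIBondY`) and is not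
claimed in the corner key; (L8) is NOT claimed for it (located fact above).  `QknitY i` satisfies (L1) (`QknitY_one`), (L3) with the generic partner at
every `U`, and (L8) at `parKnitY i` in the (52)-currency (`QknitY_gradY_GpPhysY_RY_parKnitY` ✓) — recorded here as the nonvacuity witness
`isNullOnQ_QknitY_pdev`, and BY NAME from dag-n06-l's landed `B9Eq3115KnitLetterYLaws` ∕ `B9Eq3124HZKnitPairReg335Y`: (L5) `isCovCornerQ_QknitY`
(`QknitY_cov`), (L4) `isRealOnQ_QknitY_pdev` (`QknitY_isRealOpY`), (L8) on the certificate's class (3.35) `isNullOnQ_QknitY_reg335`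
(`QknitY_gradY_GpPhysY_RY_parKnitY_of_reg335P`) with `parKnitY_mem_unitary_of_regQY`; (L2) is `…YLaws.QknitY_apply_congr` (box-keyed, not folded); (L6) for `QknitY` on the class is THE open estimate of R2-A (dag-n06-l lineage; [5] (127), [B9] p. 419);
(L7) for `QknitY` is dag-n06-c's.

HONEST SCOPE.  Definitions (types, Props, the generic adjoint, two instances) and the laws that follow from LANDED theorems by name; the one new
argument is the finite-sum verification that `adjTrY T` is the trace-pairing adjoint (§1).  No claim about (3.115) for the straight-contour letter, no
estimate, nothing of N06 discharged; count-neutral (pub-ymgap `KPS=… N06 …` unmoved).  Nothing here bears on reflection positivity, a continuum ∕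
infinite-volume limit, or the Yang–Mills mass gap.
-/

noncomputable section

open scoped BigOperators

namespace Literature.MathematicalPhysics.QuantumFieldTheory.Balaban1983to89.Node00.OpsYQLetter

open Node00
open B6GlobalChartV1 (PV)
open B6KLevelCensusIndexV1 (KIdx)
open B9BackgroundsKLevelV1P (bg9KP reg335P_iff)
open B9Thm311ReadingCoords (trIP IsAdjTr)
open B9Thm311AdjointPairs (isAdjTr_QY_QsY isAdjTr_QY_QsY_parBY)
open B9Eq3115KnitLetterY (QknitY QknitY_one QknitY_gradY_GpPhysY_RY_parKnitY)
open B9B8AveragingJunction (parKnitY)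
open B9B8CarrierDictionary (liftCfg)
open B9C2LettersTorusYCov (gSrcCornerY)
open B7Prop1Explicit (U1)
open B7Prop2Explicit (unitaryUnits pdev AvgClosed C0 c2')
open B9Eq3132Ineq2142Covariant (norm_QY_apply_le)
open B6KLevelCensusIndexV1 (kGeo)
open B9C2FormBoxRegimeY (Kpl)
open B9Eq3115KnitLetterYLaws (QknitY_cov QknitY_isRealOpY)
open B9Eq3124HZKnitPairReg335Y (QknitY_gradY_GpPhysY_RY_parKnitY_of_reg335P parKnitY_mem_unitary_of_reg335P)
open scoped Matrix.Norms.L2Operator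

/-! ## §1 The generic adjoint for the trace pairings -/

section Generic

variable {N : ℕ} {X Y : Type} [Fintype X] [Fintype Y] [DecidableEq X]

/-- the SESQUILINEAR trace pairing `Σ_y tr(Φ(y)ᴴ Ψ(y)) = Σ_y Σ_{c,e} conj(Φ(y)_{ce})·Ψ(y)_{ce}` of matrix-valued lattice functions; its real part is
print's scalar product at unit weight (`trIP_one_eq_re_trSesqY`). [cite: Balaban1985BackgroundPropagators, p.393 (scalar products), dictionary] -/
def trSesqY (Φ Ψ : Y → Matrix (Fin N) (Fin N) ℂ) : ℂ := ∑ y, ∑ c, ∑ e, star (Φ y c e) * Ψ y c e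

omit [DecidableEq X] in
/-- print's unit-weight scalar product is the real part of the sesquilinear trace pairing. [cite: Balaban1985BackgroundPropagators, p.393 (scalar products), bookkeeping] -/
theorem trIP_one_eq_re_trSesqY (Φ Ψ : Y → Matrix (Fin N) (Fin N) ℂ) : trIP (fun _ => (1 : ℝ)) Φ Ψ = (trSesqY Φ Ψ).re := by
  simp only [trIP, one_mul, trSesqY, Complex.re_sum]

/-- additivity of the pairing on the left. [cite: Balaban1985BackgroundPropagators, p.393 (scalar products), bookkeeping] -/
theorem trSesqY_add_left (Φ Φ' Ψ : Y → Matrix (Fin N) (Fin N) ℂ) : trSesqY (Φ + Φ') Ψ = trSesqY Φ Ψ + trSesqY Φ' Ψ := by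
  simp only [trSesqY, Pi.add_apply, Matrix.add_apply, star_add, add_mul, Finset.sum_add_distrib]

/-- conjugate-homogeneity of the pairing on the left. [cite: Balaban1985BackgroundPropagators, p.393 (scalar products), bookkeeping] -/
theorem trSesqY_smul_left (c : ℂ) (Φ Ψ : Y → Matrix (Fin N) (Fin N) ℂ) : trSesqY (c • Φ) Ψ = star c * trSesqY Φ Ψ := by
  simp only [trSesqY, Pi.smul_apply, Matrix.smul_apply, smul_eq_mul, star_mul', mul_assoc, Finset.mul_sum]

/-- the pairing vanishes on a zero left argument. [cite: Balaban1985BackgroundPropagators, p.393 (scalar products), bookkeeping] -/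
theorem trSesqY_zero_left (Ψ : Y → Matrix (Fin N) (Fin N) ℂ) : trSesqY 0 Ψ = 0 := by
  simp only [trSesqY, Pi.zero_apply, Matrix.zero_apply, star_zero, zero_mul, Finset.sum_const_zero]

/-- finite additivity of the pairing on the left. [cite: Balaban1985BackgroundPropagators, p.393 (scalar products), bookkeeping] -/
theorem trSesqY_sum_left {κ : Type} (s : Finset κ) (F : κ → Y → Matrix (Fin N) (Fin N) ℂ) (Ψ : Y → Matrix (Fin N) (Fin N) ℂ) :
    trSesqY (∑ k ∈ s, F k) Ψ = ∑ k ∈ s, trSesqY (F k) Ψ := by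
  classical
  induction s using Finset.induction_on with
  | empty => simp only [Finset.sum_empty, trSesqY_zero_left]
  | insert _ _ hk ih => rw [Finset.sum_insert hk, Finset.sum_insert hk, trSesqY_add_left, ih]

/-- additivity of the pairing on the right. [cite: Balaban1985BackgroundPropagators, p.393 (scalar products), bookkeeping] -/
theorem trSesqY_add_right (Φ Ψ Ψ' : Y → Matrix (Fin N) (Fin N) ℂ) : trSesqY Φ (Ψ + Ψ') = trSesqY Φ Ψ + trSesqY Φ Ψ' := by
  simp only [trSesqY, Pi.add_apply, Matrix.add_apply, mul_add, Finset.sum_add_distrib]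

/-- homogeneity of the pairing on the right. [cite: Balaban1985BackgroundPropagators, p.393 (scalar products), bookkeeping] -/
theorem trSesqY_smul_right (c : ℂ) (Φ Ψ : Y → Matrix (Fin N) (Fin N) ℂ) : trSesqY Φ (c • Ψ) = c * trSesqY Φ Ψ := by
  simp only [trSesqY, Pi.smul_apply, Matrix.smul_apply, smul_eq_mul, mul_left_comm _ c, Finset.mul_sum]

/-- the matrix unit `E_{ab}` placed at the site `x` (zero elsewhere): the basis vectors `δ_x E_{ab}` of the matrix-valued lattice functions.
[cite: Balaban1985BackgroundPropagators, p.393 (scalar products), dictionary] -/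
def unitFnY (x : X) (a b : Fin N) : X → Matrix (Fin N) (Fin N) ℂ := Pi.single x (Matrix.single a b 1)

omit [Fintype X] in
/-- the basis vector, evaluated. [cite: Balaban1985BackgroundPropagators, p.393 (scalar products), bookkeeping] -/
theorem unitFnY_apply (x x' : X) (a b c e : Fin N) : unitFnY x a b x' c e = if x' = x then (if a = c ∧ b = e then 1 else 0) else 0 := by
  unfold unitFnY
  by_cases h : x' = x
  · subst h; rw [Pi.single_eq_same, if_pos rfl, Matrix.single_apply]
  · rw [Pi.single_eq_of_ne h, if_neg h, Matrix.zero_apply]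

omit [Fintype X] in
/-- the basis vector at its own site. [cite: Balaban1985BackgroundPropagators, p.393 (scalar products), bookkeeping] -/
theorem unitFnY_apply_same (x : X) (a b c e : Fin N) : unitFnY x a b x c e = if a = c ∧ b = e then 1 else 0 := by
  unfold unitFnY
  rw [Pi.single_eq_same, Matrix.single_apply]

omit [Fintype X] in
/-- the basis vector away from its site. [cite: Balaban1985BackgroundPropagators, p.393 (scalar products), bookkeeping] -/
theorem unitFnY_apply_of_ne {x x' : X} (h : x' ≠ x) (a b c e : Fin N) : unitFnY x a b x' c e = 0 := by
  unfold unitFnY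
  rw [Pi.single_eq_of_ne h, Matrix.zero_apply]

/-- every matrix-valued lattice function is the finite combination `Φ = Σ_{x,a,b} Φ(x)_{ab}·δ_x E_{ab}` of the basis vectors.
[cite: Balaban1985BackgroundPropagators, p.393 (scalar products), bookkeeping] -/
theorem eq_sum_unitFnY (Φ : X → Matrix (Fin N) (Fin N) ℂ) : Φ = ∑ x, ∑ a, ∑ b, Φ x a b • unitFnY x a b := by
  funext x'
  ext c e
  simp only [Finset.sum_apply, Matrix.sum_apply, Pi.smul_apply, Matrix.smul_apply, smul_eq_mul]
  rw [Finset.sum_eq_single_of_mem x' (Finset.mem_univ x') (fun x _ hx =>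
    Finset.sum_eq_zero fun a _ => Finset.sum_eq_zero fun b _ => by rw [unitFnY_apply_of_ne (Ne.symm hx), mul_zero])]
  simp only [unitFnY_apply_same]
  rw [Finset.sum_eq_single_of_mem c (Finset.mem_univ c) (fun a _ ha => Finset.sum_eq_zero fun b _ => by rw [if_neg (fun h => ha h.1), mul_zero]),
    Finset.sum_eq_single_of_mem e (Finset.mem_univ e) (fun b _ hb => by rw [if_neg (fun h => hb h.2), mul_zero]), if_pos ⟨rfl, rfl⟩, mul_one]

/-- ★ **THE GENERIC ADJOINT FOR THE TRACE PAIRINGS**: for a `ℂ`-linear operator `T` of matrix-valued lattice functions, the operator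
`(adjTrY T Ψ)(x)_{ab} := Σ_y tr((T δ_x E_{ab})(y)ᴴ Ψ(y))` — the Hermitian adjoint of `T` for the sesquilinear trace pairing, hence (real parts) the
adjoint for print's scalar products («Q′* the adjoint of Q′», «∇* of ∇», «Q*»).
[cite: Balaban1985BackgroundPropagators, p.393 (scalar products; Q′* the adjoint of Q′), (3.8) p.392, (3.13) p.393] -/
def adjTrY (T : (X → Matrix (Fin N) (Fin N) ℂ) →ₗ[ℂ] (Y → Matrix (Fin N) (Fin N) ℂ)) :
    (Y → Matrix (Fin N) (Fin N) ℂ) →ₗ[ℂ] (X → Matrix (Fin N) (Fin N) ℂ) where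
  toFun Ψ x := Matrix.of fun a b => trSesqY (T (unitFnY x a b)) Ψ
  map_add' Ψ Ψ' := by
    funext x; ext a b
    simp only [Matrix.of_apply, Pi.add_apply, Matrix.add_apply, trSesqY_add_right]
  map_smul' c Ψ := by
    funext x; ext a b
    simp only [Matrix.of_apply, Pi.smul_apply, Matrix.smul_apply, smul_eq_mul, trSesqY_smul_right, RingHom.id_apply]

omit [Fintype X] in
/-- the generic adjoint, evaluated. [cite: Balaban1985BackgroundPropagators, p.393 (scalar products), bookkeeping] -/
theorem adjTrY_apply (T : (X → Matrix (Fin N) (Fin N) ℂ) →ₗ[ℂ] (Y → Matrix (Fin N) (Fin N) ℂ)) (Ψ : Y → Matrix (Fin N) (Fin N) ℂ) (x : X) (a b : Fin N) :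
    adjTrY T Ψ x a b = trSesqY (T (unitFnY x a b)) Ψ := rfl

/-- ★ **THE ADJOINT IDENTITY** for the sesquilinear trace pairing: `⟨TΦ, Ψ⟩ = ⟨Φ, T†Ψ⟩`. [cite: Balaban1985BackgroundPropagators, p.393 (scalar products; Q′* the adjoint of Q′)] -/
theorem trSesqY_map_left (T : (X → Matrix (Fin N) (Fin N) ℂ) →ₗ[ℂ] (Y → Matrix (Fin N) (Fin N) ℂ)) (Φ : X → Matrix (Fin N) (Fin N) ℂ)
    (Ψ : Y → Matrix (Fin N) (Fin N) ℂ) : trSesqY (T Φ) Ψ = trSesqY Φ (adjTrY T Ψ) := by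
  conv_lhs => rw [eq_sum_unitFnY Φ]
  simp only [map_sum, map_smul, trSesqY_sum_left, trSesqY_smul_left]
  simp only [trSesqY, adjTrY_apply]

/-- ★★ **`adjTrY T` IS THE ADJOINT OF `T` FOR PRINT'S SCALAR PRODUCTS** (unit weights), for EVERY `ℂ`-linear `T` — no hypothesis on `T`.
[cite: Balaban1985BackgroundPropagators, p.393 (scalar products; Q′* the adjoint of Q′), (3.13) p.393] -/
theorem isAdjTr_adjTrY (T : (X → Matrix (Fin N) (Fin N) ℂ) →ₗ[ℂ] (Y → Matrix (Fin N) (Fin N) ℂ)) :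
    IsAdjTr (fun _ => (1 : ℝ)) (fun _ => (1 : ℝ)) T (adjTrY T) := fun Φ Ψ => by
  rw [trIP_one_eq_re_trSesqY, trIP_one_eq_re_trSesqY, trSesqY_map_left]

omit [Fintype X] in
/-- the Hermitian conjugate of a basis vector is the transposed basis vector: `(δ_x E_{ab})ᴴ = δ_x E_{ba}`. [cite: Balaban1985BackgroundPropagators, p.391 (hermitian-valued functions), bookkeeping] -/
theorem star_unitFnY (x : X) (a b : Fin N) : star (unitFnY (N := N) x a b) = unitFnY x b a := by
  funext x'
  ext c e
  rw [Pi.star_apply, Matrix.star_apply, unitFnY_apply, unitFnY_apply]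
  by_cases h : x' = x
  · rw [if_pos h, if_pos h]
    by_cases h' : a = e ∧ b = c
    · rw [if_pos h', if_pos (And.intro h'.2 h'.1), star_one]
    · rw [if_neg h', if_neg (fun h'' => h' (And.intro h''.2 h''.1)), star_zero]
  · rw [if_neg h, if_neg h, star_zero]

/-- the pairing against a Hermitian-conjugated right argument. [cite: Balaban1985BackgroundPropagators, p.391 (hermitian-valued functions), bookkeeping] -/
theorem trSesqY_star_right (Φ Ψ : Y → Matrix (Fin N) (Fin N) ℂ) : trSesqY Φ (star Ψ) = star (trSesqY (star Φ) Ψ) := by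
  simp only [trSesqY, star_sum, star_mul', star_star, Pi.star_apply, Matrix.star_apply]
  exact Finset.sum_congr rfl fun y _ => Finset.sum_comm

omit [Fintype X] in
/-- ★ **THE ADJOINT OF A REAL OPERATOR IS REAL**: if `T` maps hermitian-valued functions to hermitian-valued functions, so does `adjTrY T`.
[cite: Balaban1985BackgroundPropagators, p.391 (hermitian-valued functions), (3.13) p.393] -/
theorem _root_.Literature.MathematicalPhysics.QuantumFieldTheory.Balaban1983to89.Node00.IsRealOpY.adjTrY
    {T : (X → Matrix (Fin N) (Fin N) ℂ) →ₗ[ℂ] (Y → Matrix (Fin N) (Fin N) ℂ)} (hT : IsRealOpY T) : IsRealOpY (adjTrY T) := fun Ψ => by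
  funext x
  ext a b
  rw [adjTrY_apply, Pi.star_apply, Matrix.star_apply, adjTrY_apply, trSesqY_star_right, ← hT.apply, star_unitFnY]

omit [DecidableEq X] in
/-- ★ **UNIQUENESS OF THE ADJOINT** for print's unit-weight scalar product (a positive definite pairing: `B9Thm311ReadingCoords.realify311`).
[cite: Balaban1985BackgroundPropagators, p.393 (scalar products)] -/
theorem eq_of_isAdjTr_one {T : (X → Matrix (Fin N) (Fin N) ℂ) →ₗ[ℂ] (Y → Matrix (Fin N) (Fin N) ℂ)}
    {S S' : (Y → Matrix (Fin N) (Fin N) ℂ) →ₗ[ℂ] (X → Matrix (Fin N) (Fin N) ℂ)} (h : IsAdjTr (fun _ => (1 : ℝ)) (fun _ => (1 : ℝ)) T S)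
    (h' : IsAdjTr (fun _ => (1 : ℝ)) (fun _ => (1 : ℝ)) T S') : S = S' := by
  apply LinearMap.ext
  intro Ψ
  have hw : ∀ _ : X, (0 : ℝ) < 1 := fun _ => one_pos
  apply (B9Thm311ReadingCoords.realify311 (fun _ => (1 : ℝ)) hw).injective
  refine ext_inner_left ℝ fun v => ?_
  obtain ⟨Φ, rfl⟩ := (B9Thm311ReadingCoords.realify311 (fun _ => (1 : ℝ)) hw).surjective v
  rw [B9Thm311ReadingCoords.inner_realify311, B9Thm311ReadingCoords.inner_realify311, ← h Φ Ψ, ← h' Φ Ψ]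

/-- ★ hence ANY adjoint partner for the unit-weight scalar product IS the generic adjoint. [cite: Balaban1985BackgroundPropagators, p.393 (scalar products), (3.13) p.393] -/
theorem adjTrY_eq_of_isAdjTr {T : (X → Matrix (Fin N) (Fin N) ℂ) →ₗ[ℂ] (Y → Matrix (Fin N) (Fin N) ℂ)}
    {S : (Y → Matrix (Fin N) (Fin N) ℂ) →ₗ[ℂ] (X → Matrix (Fin N) (Fin N) ℂ)} (h : IsAdjTr (fun _ => (1 : ℝ)) (fun _ => (1 : ℝ)) T S) : adjTrY T = S :=
  eq_of_isAdjTr_one (isAdjTr_adjTrY T) h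

end Generic

/-! ## §2 The type of an averaging letter and its laws -/

section Laws

variable {d ℓ : ℕ} {hd : 1 ≤ d + 1} {hL : Odd (ℓ + 1) ∧ 1 < ℓ + 1} {b₀ b₁ : ℝ}
variable (𝔸 : Type) [NormedRing 𝔸] [NormedAlgebra ℂ 𝔸] [CompleteSpace 𝔸]
variable (i : KIdx d ℓ hd hL b₀ b₁)

/-- ★ **THE TYPE OF AN AVERAGING LETTER** `U ↦ Q(U) : (bond functions) → (coarse-bond functions)`, `ℂ`-linear at each configuration.
[cite: Balaban1985BackgroundPropagators, (3.12)–(3.14) p.393] [cite: Balaban1985Averaging, (14) p.19, (15) p.19] -/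
abbrev QLetterY : Type := CfgY 𝔸 i → ((FBondY i → 𝔸) →ₗ[ℂ] (IBondY i → 𝔸))

/-- the type of an adjoint averaging letter `U ↦ Q*(U)`. [cite: Balaban1985BackgroundPropagators, (3.13) p.393] -/
abbrev QsLetterY : Type := CfgY 𝔸 i → ((IBondY i → 𝔸) →ₗ[ℂ] (FBondY i → 𝔸))

/-- the type of a REGIME: a class of configurations over which the regime laws are quantified (the record: the member's local class (3.35)).
[cite: Balaban1985BackgroundPropagators, (3.35) p.396] -/
abbrev RegimeY : Type := CfgY 𝔸 i → Prop

variable {𝔸 i}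

/-- (L1) ★ **FLATNESS**: at the trivial configuration the letter is the flat averaging `Q♯ = liftMatY (qK i)` (p. 395 «Q(1) = Q»; [5]: at `U = 1` the
composite averaging linearises to the straight-contour one). [cite: Balaban1985BackgroundPropagators, p.395 (U = 1)] [cite: Balaban1985Averaging, (14)–(15) p.19] -/
def IsFlatQ (𝔮 : QLetterY 𝔸 i) : Prop := 𝔮 (fun _ _ => 1) = liftMatY 𝔸 (qK i)

/-- (L2) ★ **LOCALITY** relative to a dependency assignment `D` (coarse bond ↦ a set of fine bonds): `(Q(U)a)(ι)` depends on the configuration `U`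
and on the bond function `a` only through their values on the bonds of `D ι` («Q … is a local operator», p. 393; for the record's instances `D ι`
lies in the double block of `ι`). [cite: Balaban1985BackgroundPropagators, (3.12)–(3.14) p.393] -/
def IsLocalQ (D : IBondY i → Set (FBondY i)) (𝔮 : QLetterY 𝔸 i) : Prop :=
  ∀ (U U' : CfgY 𝔸 i) (a a' : FBondY i → 𝔸) (ι : IBondY i),
    (∀ b ∈ D ι, U b.dir b.src = U' b.dir b.src) → (∀ b ∈ D ι, a b = a' b) → 𝔮 U a ι = 𝔮 U' a' ι

/-- (L5) ★ **CORNER-KEYED GAUGE COVARIANCE** ([5] (11) «the averaging preserves gauge transformations», (3.32)): for gauge functions `g` of unitary type,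
`Q(U^g)(R(g)a) = R(g(corner))·(Q(U)a)` — the coarse bond `ι` keyed at its SOURCE CORNER `gSrcCornerY` (director Q3: the uniform key of v10, the key
of `C2LettersY.IsCovUC`). [cite: Balaban1985Averaging, (11) p.19] [cite: Balaban1985BackgroundPropagators, (3.32)–(3.34) pp.395–396] -/
def IsCovCornerQ [NormOneClass 𝔸] (𝔮 : QLetterY 𝔸 i) : Prop :=
  ∀ g : GaugeY 𝔸 i, (∀ x, g x ∈ U1 𝔸) → ∀ U : CfgY 𝔸 i, Intw (conjY (gBondY i g)) (conjY (gSrcCornerY i g)) (𝔮 U) (𝔮 (gaugeY i g U))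

/-- (L6) ★ **ONTO ON THE REGIME**: `Q(U)` is surjective for `U` in the regime — what makes `Q G Q*` invertible on the range of `Q` and `H = G Q*(QGQ*)⁻¹`
well defined ((3.123)–(3.126)). [cite: Balaban1985BackgroundPropagators, (3.123)–(3.126) p.420] [cite: Balaban1984PropagatorsII, (2.35) p.228] -/
def IsOntoOnQ (𝓡 : RegimeY 𝔸 i) (𝔮 : QLetterY 𝔸 i) : Prop := ∀ U, 𝓡 U → Function.Surjective (𝔮 U)

/-- (L7) ★ **SIZES ON THE REGIME**: `‖(Q(U)a)(ι)‖ ≤ K·‖a‖` ((3.15): weights of total mass one, contractive transports ⇒ `K = 1` for the straight-contour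
letter). [cite: Balaban1985BackgroundPropagators, (3.15) p.393] -/
def IsBddOnQ (𝓡 : RegimeY 𝔸 i) (𝔮 : QLetterY 𝔸 i) (K : ℝ) : Prop := ∀ U, 𝓡 U → ∀ (a : FBondY i → 𝔸) (ι : IBondY i), ‖𝔮 U a ι‖ ≤ K * ‖a‖

/-- (L8) ★★ **THE (3.115)-NULLITY ON THE REGIME**, in the N06 certificate's shape (rows 20–21): `Q(U) ∘ D_U ∘ G′_phys(U) ∘ R(U) = 0` at the site
transporter `parS` («Q_U D_U λ = 0 for λ satisfying Q′λ = 0», and `Q′G′R = 0`). [cite: Balaban1985BackgroundPropagators, (3.115) p.418, (3.121)–(3.125) p.420] -/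
def IsNullOnQ (𝓡 : RegimeY 𝔸 i) (𝔮 : QLetterY 𝔸 i) (parS : SiteParY 𝔸 i) : Prop :=
  ∀ U, 𝓡 U → 𝔮 U ∘ₗ gradY i U ∘ₗ GpPhysY i parS U ∘ₗ RY i parS (GpPhysY i parS) U = 0

/-- ★ **THE REGIME OF RECORD**: the member's LOCAL regularity class (3.35) over print's cube class with per-cube constant `c` and parameter `α₀`
(`G`-valued configurations included) — the currency in which the N06 certificate quantifies its rows. [cite: Balaban1985BackgroundPropagators, (3.35) p.396] -/
def regQY (G : Subgroup 𝔸ˣ) (i : KIdx d ℓ hd hL b₀ b₁) (c α₀ : ℝ) : RegimeY 𝔸 i := fun U => (bg9KP 𝔸 G i).Reg335 c α₀ U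

/-- a configuration of the regime of record is `G`-valued. [cite: Balaban1985BackgroundPropagators, (3.35) p.396, bookkeeping] -/
theorem mem_of_regQY {G : Subgroup 𝔸ˣ} {c α₀ : ℝ} {U : CfgY 𝔸 i} (h : regQY G i c α₀ U) : ∀ μ x, U μ x ∈ G :=
  ((reg335P_iff i c α₀ U).mp h).1

/-- monotonicity of (L6) in the regime. [cite: Balaban1985BackgroundPropagators, (3.123) p.420, bookkeeping] -/
theorem IsOntoOnQ.mono {𝓡 𝓡' : RegimeY 𝔸 i} {𝔮 : QLetterY 𝔸 i} (h : IsOntoOnQ 𝓡 𝔮) (hle : ∀ U, 𝓡' U → 𝓡 U) : IsOntoOnQ 𝓡' 𝔮 :=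
  fun U hU => h U (hle U hU)

/-- monotonicity of (L7) in the regime. [cite: Balaban1985BackgroundPropagators, (3.15) p.393, bookkeeping] -/
theorem IsBddOnQ.mono {𝓡 𝓡' : RegimeY 𝔸 i} {𝔮 : QLetterY 𝔸 i} {K : ℝ} (h : IsBddOnQ 𝓡 𝔮 K) (hle : ∀ U, 𝓡' U → 𝓡 U) : IsBddOnQ 𝓡' 𝔮 K :=
  fun U hU => h U (hle U hU)

/-- monotonicity of (L8) in the regime. [cite: Balaban1985BackgroundPropagators, (3.115) p.418, bookkeeping] -/
theorem IsNullOnQ.mono {𝓡 𝓡' : RegimeY 𝔸 i} {𝔮 : QLetterY 𝔸 i} {parS : SiteParY 𝔸 i} (h : IsNullOnQ 𝓡 𝔮 parS) (hle : ∀ U, 𝓡' U → 𝓡 U) :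
    IsNullOnQ 𝓡' 𝔮 parS :=
  fun U hU => h U (hle U hU)

/-- (L2) is monotone in the dependency assignment. [cite: Balaban1985BackgroundPropagators, (3.12) p.393, bookkeeping] -/
theorem IsLocalQ.mono {D D' : IBondY i → Set (FBondY i)} {𝔮 : QLetterY 𝔸 i} (h : IsLocalQ D 𝔮) (hle : ∀ ι, D ι ⊆ D' ι) : IsLocalQ D' 𝔮 :=
  fun U U' a a' ι hU ha => h U U' a a' ι (fun b hb => hU b (hle ι hb)) (fun b hb => ha b (hle ι hb))

/-- (L2) holds trivially for the total dependency assignment (no locality claimed). [cite: Balaban1985BackgroundPropagators, (3.12) p.393, bookkeeping] -/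
theorem isLocalQ_univ (𝔮 : QLetterY 𝔸 i) : IsLocalQ (fun _ => Set.univ) 𝔮 := by
  intro U U' a a' ι hU ha
  have hUU : U = U' := funext fun μ => funext fun x => hU ⟨x, μ⟩ (Set.mem_univ _)
  have haa : a = a' := funext fun b => ha b (Set.mem_univ _)
  rw [hUU, haa]

end Laws

section LawsMatrix

variable {d ℓ : ℕ} {hd : 1 ≤ d + 1} {hL : Odd (ℓ + 1) ∧ 1 < ℓ + 1} {b₀ b₁ : ℝ} {N : ℕ}
variable {i : KIdx d ℓ hd hL b₀ b₁}

/-- (L3) ★ **ADJOINT PARTNER ON THE REGIME**: `Q*(U)` is the adjoint of `Q(U)` for print's scalar products (unit weights) for `U` in the regime.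
[cite: Balaban1985BackgroundPropagators, (3.13) p.393, p.393 (scalar products)] -/
def IsAdjOnQ (𝓡 : RegimeY (Matrix (Fin N) (Fin N) ℂ) i) (𝔮 : QLetterY (Matrix (Fin N) (Fin N) ℂ) i) (𝔮s : QsLetterY (Matrix (Fin N) (Fin N) ℂ) i) : Prop :=
  ∀ U, 𝓡 U → IsAdjTr (fun _ => (1 : ℝ)) (fun _ => (1 : ℝ)) (𝔮 U) (𝔮s U)

/-- (L4) ★ **REALITY ON THE REGIME**: `Q(U)` maps hermitian-valued bond functions to hermitian-valued coarse-bond functions for `U` in the regime.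
[cite: Balaban1985BackgroundPropagators, p.391 (hermitian-valued functions), (3.12) p.393] -/
def IsRealOnQ (𝓡 : RegimeY (Matrix (Fin N) (Fin N) ℂ) i) (𝔮 : QLetterY (Matrix (Fin N) (Fin N) ℂ) i) : Prop := ∀ U, 𝓡 U → IsRealOpY (𝔮 U)

/-- (L4*) reality of the adjoint letter on the regime. [cite: Balaban1985BackgroundPropagators, p.391 (hermitian-valued functions), (3.13) p.393] -/
def IsRealOnQs (𝓡 : RegimeY (Matrix (Fin N) (Fin N) ℂ) i) (𝔮s : QsLetterY (Matrix (Fin N) (Fin N) ℂ) i) : Prop := ∀ U, 𝓡 U → IsRealOpY (𝔮s U)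

variable [Nonempty (Fin N)] in
/-- ★★ **THE LAW BUNDLE OF AN AVERAGING LETTER** — the every-`U` laws (L1) (L2) (L5) and the regime laws (L3) (L4) (L6) (L7) (L8) over the regime `𝓡`,
for a one-binder display. [cite: Balaban1985BackgroundPropagators, (3.12)–(3.16) p.393, (3.32) p.395, (3.115) p.418, (3.123)–(3.126) p.420] [cite: Balaban1985Averaging, (11) p.19, (15) p.19] -/
structure QLawsY (𝓡 : RegimeY (Matrix (Fin N) (Fin N) ℂ) i) (D : IBondY i → Set (FBondY i)) (𝔮 : QLetterY (Matrix (Fin N) (Fin N) ℂ) i)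
    (𝔮s : QsLetterY (Matrix (Fin N) (Fin N) ℂ) i) (parS : SiteParY (Matrix (Fin N) (Fin N) ℂ) i) (K : ℝ) : Prop where
  flat : IsFlatQ 𝔮
  isLocal : IsLocalQ D 𝔮
  cov : IsCovCornerQ 𝔮
  adj : IsAdjOnQ 𝓡 𝔮 𝔮s
  real : IsRealOnQ 𝓡 𝔮
  onto : IsOntoOnQ 𝓡 𝔮
  bdd : IsBddOnQ 𝓡 𝔮 K
  null : IsNullOnQ 𝓡 𝔮 parS

/-- monotonicity of (L3) in the regime. [cite: Balaban1985BackgroundPropagators, (3.13) p.393, bookkeeping] -/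
theorem IsAdjOnQ.mono {𝓡 𝓡' : RegimeY (Matrix (Fin N) (Fin N) ℂ) i} {𝔮 : QLetterY (Matrix (Fin N) (Fin N) ℂ) i} {𝔮s : QsLetterY (Matrix (Fin N) (Fin N) ℂ) i}
    (h : IsAdjOnQ 𝓡 𝔮 𝔮s) (hle : ∀ U, 𝓡' U → 𝓡 U) : IsAdjOnQ 𝓡' 𝔮 𝔮s :=
  fun U hU => h U (hle U hU)

/-- monotonicity of (L4) in the regime. [cite: Balaban1985BackgroundPropagators, p.391, bookkeeping] -/
theorem IsRealOnQ.mono {𝓡 𝓡' : RegimeY (Matrix (Fin N) (Fin N) ℂ) i} {𝔮 : QLetterY (Matrix (Fin N) (Fin N) ℂ) i} (h : IsRealOnQ 𝓡 𝔮) (hle : ∀ U, 𝓡' U → 𝓡 U) :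
    IsRealOnQ 𝓡' 𝔮 :=
  fun U hU => h U (hle U hU)

/-- ★ (L3) FOR FREE: the generic adjoint `adjTrY ∘ 𝔮` is an adjoint partner of ANY letter on ANY regime. [cite: Balaban1985BackgroundPropagators, (3.13) p.393, p.393 (scalar products)] -/
theorem isAdjOnQ_adjTrY (𝓡 : RegimeY (Matrix (Fin N) (Fin N) ℂ) i) (𝔮 : QLetterY (Matrix (Fin N) (Fin N) ℂ) i) : IsAdjOnQ 𝓡 𝔮 fun U => adjTrY (𝔮 U) :=
  fun U _ => isAdjTr_adjTrY (𝔮 U)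

/-- ★ (L4*) from (L4): the generic adjoint of a letter real on the regime is real on the regime. [cite: Balaban1985BackgroundPropagators, p.391, (3.13) p.393] -/
theorem IsRealOnQ.adjTrY {𝓡 : RegimeY (Matrix (Fin N) (Fin N) ℂ) i} {𝔮 : QLetterY (Matrix (Fin N) (Fin N) ℂ) i} (h : IsRealOnQ 𝓡 𝔮) :
    IsRealOnQs 𝓡 fun U => adjTrY (𝔮 U) :=
  fun U hU => (h U hU).adjTrY

end LawsMatrix

/-! ## §3 The two letters at a k-level index: the laws they satisfy today, by name -/

section StraightContour

variable {d ℓ : ℕ} {hd : 1 ≤ d + 1} {hL : Odd (ℓ + 1) ∧ 1 < ℓ + 1} {b₀ b₁ : ℝ}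
variable {𝔸 : Type} [NormedRing 𝔸] [NormedAlgebra ℂ 𝔸] [CompleteSpace 𝔸]
variable (i : KIdx d ℓ hd hL b₀ b₁)

/-- (L1) for the straight-contour letter at ANY bond transporter table flat at `U = 1`. [cite: Balaban1985BackgroundPropagators, p.395 (Q(1) = Q)] -/
theorem isFlatQ_QY (parB : BondParY 𝔸 i) (hpar : ∀ s s', parB (fun _ _ => 1) s s' = 1) : IsFlatQ (QY i parB) := QY_one i hpar

/-- ★ (L1) for the straight-contour letter of record (`parBY`). [cite: Balaban1985BackgroundPropagators, p.395 (Q(1) = Q)] -/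
theorem isFlatQ_QY_parBY : IsFlatQ (QY i (parBY (𝔸 := 𝔸) i)) := QY_one i (parBY_one i)

/-- ★ (L6) for the straight-contour letter: onto at EVERY configuration and every transporter table (triangularity of the kernel).
[cite: Balaban1985BackgroundPropagators, (3.123)–(3.126) p.420] -/
theorem isOntoOnQ_QY (𝓡 : RegimeY 𝔸 i) (parB : BondParY 𝔸 i) : IsOntoOnQ 𝓡 (QY i parB) := fun U _ => QY_surjective i parB U

variable [NormOneClass 𝔸] in
/-- ★ (L7) with `K = 1` for the straight-contour letter of record on the regime of record, `G` of unitary type. [cite: Balaban1985BackgroundPropagators, (3.15) p.393] [cite: Balaban1984PropagatorsI, (1.18) p.20] -/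
theorem isBddOnQ_QY_parBY {G : Subgroup 𝔸ˣ} (hG1 : G ≤ U1 𝔸) (c α₀ : ℝ) : IsBddOnQ (regQY G i c α₀) (QY i (parBY i)) 1 := by
  intro U hU a ι
  rw [one_mul]
  have hmem := mem_of_regQY (i := i) hU
  exact norm_QY_apply_le i (parBY i) U (fun s s' => hG1 (parBY_mem i hmem s s')) a ι fun f _ => norm_le_pi_norm a f

variable [NormOneClass 𝔸] in
/-- ★ (L1) FOR THE KNIT LETTER: at `U = 1` the knit averaging is the flat one ([5] (15) at `U = 1`; `QknitY_one` + `QY_one`).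
[cite: Balaban1985Averaging, (14)–(15) p.19] [cite: Balaban1985BackgroundPropagators, p.395 (Q(1) = Q)] -/
theorem isFlatQ_QknitY : IsFlatQ (QknitY (𝔸 := 𝔸) i) := by
  rw [IsFlatQ, QknitY_one i (parBY i) (parBY_one i)]
  exact QY_one i (parBY_one i)

variable [NormOneClass 𝔸] in
/-- ★ (L5) FOR THE KNIT LETTER, by name: dag-n06-l's `B9Eq3115KnitLetterYLaws.QknitY_cov` IS the corner-keyed covariance law ([5] (11); (3.32)).
[cite: Balaban1985Averaging, (11) p.19] [cite: Balaban1985BackgroundPropagators, (3.32)–(3.34) pp.395–396] -/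
theorem isCovCornerQ_QknitY : IsCovCornerQ (QknitY (𝔸 := 𝔸) i) := fun _ hg U => QknitY_cov i hg U

end StraightContour

section Matrix

variable {d ℓ : ℕ} {hd : 1 ≤ d + 1} {hL : Odd (ℓ + 1) ∧ 1 < ℓ + 1} {b₀ b₁ : ℝ} {N : ℕ}
variable (i : KIdx d ℓ hd hL b₀ b₁)

/-- ★ (L3) for the pair of record (`QY parBY`, `QsY parBY`) on the regime of record, `G ≤ U(N)` ((3.13) at unitary transporters).
[cite: Balaban1985BackgroundPropagators, (3.13) p.393, (3.35) p.396] -/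
theorem isAdjOnQ_QY_QsY_parBY {G : Subgroup (Matrix (Fin N) (Fin N) ℂ)ˣ} (hG : G ≤ unitaryUnits (Matrix (Fin N) (Fin N) ℂ)) (c α₀ : ℝ) :
    IsAdjOnQ (regQY G i c α₀) (QY i (parBY i)) (QsY i (parBY i)) :=
  fun U hU => isAdjTr_QY_QsY_parBY i hG U (mem_of_regQY (i := i) hU)

/-- ★★ **CONSISTENCY OF THE GENERIC ADJOINT WITH THE RECORD**: at a `G`-valued configuration, `G ≤ U(N)`, the generic adjoint of the straight-contour
letter of record IS the record's `Q*(U)` of (3.13) (`QsY parBY`). [cite: Balaban1985BackgroundPropagators, (3.13) p.393] -/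
theorem adjTrY_QY_parBY {G : Subgroup (Matrix (Fin N) (Fin N) ℂ)ˣ} (hG : G ≤ unitaryUnits (Matrix (Fin N) (Fin N) ℂ))
    {U : CfgY (Matrix (Fin N) (Fin N) ℂ) i} (hU : ∀ μ x, U μ x ∈ G) : adjTrY (QY i (parBY i) U) = QsY i (parBY i) U :=
  adjTrY_eq_of_isAdjTr (isAdjTr_QY_QsY_parBY i hG U hU)

/-- ★ (L4) for the straight-contour letter of record on the regime of record, `G ≤ U(N)`. [cite: Balaban1985BackgroundPropagators, p.391, (3.12) p.393] -/
theorem isRealOnQ_QY_parBY {G : Subgroup (Matrix (Fin N) (Fin N) ℂ)ˣ} (hG : G ≤ unitaryUnits (Matrix (Fin N) (Fin N) ℂ)) (c α₀ : ℝ) :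
    IsRealOnQ (regQY G i c α₀) (QY i (parBY i)) :=
  fun U hU => QY_isRealOpY i U (parBY i) (parBY_mem_unitary i fun μ x => hG (mem_of_regQY (i := i) hU μ x))

/-- ★ (L4*) for the adjoint letter of record on the regime of record, `G ≤ U(N)`. [cite: Balaban1985BackgroundPropagators, p.391, (3.13) p.393] -/
theorem isRealOnQs_QsY_parBY {G : Subgroup (Matrix (Fin N) (Fin N) ℂ)ˣ} (hG : G ≤ unitaryUnits (Matrix (Fin N) (Fin N) ℂ)) (c α₀ : ℝ) :
    IsRealOnQs (regQY G i c α₀) (QsY i (parBY i)) :=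
  fun U hU => QsY_isRealOpY i U (parBY i) (parBY_mem_unitary i fun μ x => hG (mem_of_regQY (i := i) hU μ x))

/-- ★ (L8) NONVACUITY FOR THE KNIT LETTER, (52)-CURRENCY: on `G`-valued configurations with globally small plaquette deviation at scale `k` ([5] (52)),
`G ≤ U(N)` closed under averaging, the knit letter satisfies (3.115) at `parKnitY` (dag-n06-l ✓ `QknitY_gradY_GpPhysY_RY_parKnitY`).  NOT the
certificate's currency (the local class (3.35) does not give (52) at scale `k`); the (3.35)-keyed supplier is dag-n06-l's `…_of_reg335P`.
[cite: Balaban1985BackgroundPropagators, (3.115) p.418] [cite: Balaban1985Averaging, (52) p.26] -/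
theorem isNullOnQ_QknitY_pdev [Nonempty (Fin N)] {G : Subgroup (Matrix (Fin N) (Fin N) ℂ)ˣ} (hGU : G ≤ unitaryUnits (Matrix (Fin N) (Fin N) ℂ))
    (hG : AvgClosed (d + 1) (ℓ + 1) G) {α₀ : ℝ} (hα : 0 < α₀) (hα3 : C0 (d + 1) * α₀ ≤ 1 / 3) (hα2 : 2 * α₀ ≤ c2' (d + 1) (ℓ + 1)) :
    IsNullOnQ (fun U : CfgY (Matrix (Fin N) (Fin N) ℂ) i => (∀ μ x, U μ x ∈ G) ∧ pdev (liftCfg U) < α₀ * ((((ℓ + 1 : ℕ) : ℝ) ^ i.k)⁻¹) ^ 2)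
      (QknitY i) (parKnitY i) :=
  fun _ hU => QknitY_gradY_GpPhysY_RY_parKnitY i hGU hG hU.1 hα hα3 hα2 hU.2

/-- ★ (L4) FOR THE KNIT LETTER in the (52)-currency, by name: dag-n06-l's `B9Eq3115KnitLetterYLaws.QknitY_isRealOpY` (skew fields go to skew fields).
[cite: Balaban1985BackgroundPropagators, p.391 («hermitian matrices»), (3.12)–(3.15) p.393] [cite: Balaban1985Averaging, (22)–(23) p.21, (127) p.37] -/
theorem isRealOnQ_QknitY_pdev [Nonempty (Fin N)] {G : Subgroup (Matrix (Fin N) (Fin N) ℂ)ˣ} (hGU : G ≤ unitaryUnits (Matrix (Fin N) (Fin N) ℂ))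
    (hG : AvgClosed (d + 1) (ℓ + 1) G) {α₀ : ℝ} (hα : 0 < α₀) (hα3 : C0 (d + 1) * α₀ ≤ 1 / 3) (hα4 : 4 * α₀ ≤ c2' (d + 1) (ℓ + 1))
    (hexp : Real.exp (4 * (800 * (((d + 1 : ℕ) : ℝ) + 1) ^ 2 * (((d + 1 : ℕ) : ℝ) + 4)) * α₀) < 2) :
    IsRealOnQ (fun U : CfgY (Matrix (Fin N) (Fin N) ℂ) i => (∀ μ x, U μ x ∈ G) ∧ pdev (liftCfg U) < α₀ * ((((ℓ + 1 : ℕ) : ℝ) ^ i.k)⁻¹) ^ 2)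
      (QknitY i) :=
  fun _ hU => QknitY_isRealOpY i hGU hG hU.1 hα hα3 hα4 hU.2 hexp

/-- ★★ (L8) FOR THE KNIT LETTER ON THE CERTIFICATE'S CLASS (3.35), by name: dag-n06-l's `B9Eq3124HZKnitPairReg335Y.QknitY_gradY_GpPhysY_RY_parKnitY_of_reg335P`
— `Q̄(U)·D_U·Γ_phys(U)·R(U) = 0` at the knit's own site transporter `parKnitY`, for every `U ∈ Reg335 c₀ α₀` (`c₀ ≤ 10`, `0 ≤ Mα₀`) and an auxiliary
Prop-2-small `α₀′` with `K₊(Mα₀)·L⁴ < α₀′` (director-ym №375: THE supplier of the v10 `hZ` fold). [cite: Balaban1985BackgroundPropagators, (3.115) p.418, (3.35) p.396] [cite: Balaban1985Averaging, Prop. 2 p.26] -/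
theorem isNullOnQ_QknitY_reg335 [Nonempty (Fin N)] {G : Subgroup (Matrix (Fin N) (Fin N) ℂ)ˣ}
    (hG1 : ∀ u : (Matrix (Fin N) (Fin N) ℂ)ˣ, u ∈ G → ‖(u : Matrix (Fin N) (Fin N) ℂ)‖ ≤ 1) (hGU : G ≤ unitaryUnits (Matrix (Fin N) (Fin N) ℂ))
    {c₀ α₀ : ℝ} (hc : c₀ ≤ 10) (hMα : 0 ≤ (kGeo i).M * α₀) {α₀' : ℝ} (hα' : 0 < α₀') (hα3 : C0 (d + 1) * α₀' ≤ 1 / 3)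
    (hα2 : 2 * α₀' ≤ c2' (d + 1) (ℓ + 1)) (hK : Kpl i ((kGeo i).M * α₀) * (kGeo i).L ^ 4 < α₀') :
    IsNullOnQ (regQY G i c₀ α₀) (QknitY i) (parKnitY i) :=
  fun _ hU => QknitY_gradY_GpPhysY_RY_parKnitY_of_reg335P i hG1 hGU hc hMα hU hα' hα3 hα2 hK

/-- on the same class the knit's site transporter is unitary-valued — the `hpar` of every `parKnitY`-consumer of the v10 chain, by name
(`B9Eq3124HZKnitPairReg335Y.parKnitY_mem_unitary_of_reg335P`). [cite: Balaban1985BackgroundPropagators, (3.35) p.396] [cite: Balaban1985Averaging, Prop. 2 p.26] -/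
theorem parKnitY_mem_unitary_of_regQY [Nonempty (Fin N)] {G : Subgroup (Matrix (Fin N) (Fin N) ℂ)ˣ}
    (hG1 : ∀ u : (Matrix (Fin N) (Fin N) ℂ)ˣ, u ∈ G → ‖(u : Matrix (Fin N) (Fin N) ℂ)‖ ≤ 1) (hGU : G ≤ unitaryUnits (Matrix (Fin N) (Fin N) ℂ))
    {c₀ α₀ : ℝ} (hc : c₀ ≤ 10) (hMα : 0 ≤ (kGeo i).M * α₀) {α₀' : ℝ} (hα' : 0 < α₀') (hα3 : C0 (d + 1) * α₀' ≤ 1 / 3)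
    (hα2 : 2 * α₀' ≤ c2' (d + 1) (ℓ + 1)) (hK : Kpl i ((kGeo i).M * α₀) * (kGeo i).L ^ 4 < α₀') {U : CfgY (Matrix (Fin N) (Fin N) ℂ) i}
    (hU : regQY G i c₀ α₀ U) (z w : SiteY i) : parKnitY i U z w ∈ unitaryUnits (Matrix (Fin N) (Fin N) ℂ) :=
  parKnitY_mem_unitary_of_reg335P i hG1 hGU U hc hMα hU hα' hα3 hα2 hK z w

end Matrix

/-! ## §4 The families of record over the k-level indices of a stage (read at a member `x` as `𝔮 x.toKIdx`; the `Ω′`-letter of Thm 3.14 is `𝔮 x.snd`) -/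

section Record

variable (N : ℕ) (θ : Stage3Params)

/-- ★ **THE TYPE OF AN AVERAGING-LETTER FAMILY** over the k-level indices of the stage (the parameter `𝔮` of the v10 record chain; INDEX-level like `GAv4Y`, so that both `𝔮 x.toKIdx` and the second-sequence letter `𝔮 x.snd` of Thm 3.14 are available at a member `x`).
[cite: Balaban1985BackgroundPropagators, (3.12)–(3.14) p.393] [cite: Balaban1985Averaging, (15) p.19] -/
abbrev QFamY : Type := ∀ i : KIdx θ.d₆ θ.ℓ₆ θ.hd' θ.hL' θ.b₀ θ.b₁, QLetterY (Matrix (Fin N) (Fin N) ℂ) i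

/-- the type of an adjoint-averaging-letter family over the indices. [cite: Balaban1985BackgroundPropagators, (3.13) p.393] -/
abbrev QsFamY : Type := ∀ i : KIdx θ.d₆ θ.ℓ₆ θ.hd' θ.hL' θ.b₀ θ.b₁, QsLetterY (Matrix (Fin N) (Fin N) ℂ) i

/-- ★★ **THE STRAIGHT-CONTOUR AVERAGING FAMILY OF RECORD** `𝔮 := (i ↦ QY i (parBY i))` — the letter of every v ≤ 9 record (definitionally).
[cite: Balaban1985BackgroundPropagators, (3.12)–(3.14) p.393] -/
def qYOfRecord : QFamY N θ := fun i => QY i (parBY i)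

/-- ★ its adjoint family of record `(i ↦ QsY i (parBY i))`. [cite: Balaban1985BackgroundPropagators, (3.13) p.393] -/
def qsYOfRecord : QsFamY N θ := fun i => QsY i (parBY i)

/-- ★★ **THE KNIT (COMPOSITE) AVERAGING FAMILY OF RECORD** `𝔮 := (i ↦ QknitY i)` — the linearisation of [5]'s averaging, print's `Q` of (3.115)
(dag-n06-l's letter). [cite: Balaban1985Averaging, (15)–(23) pp.19–21] [cite: Balaban1985BackgroundPropagators, (3.115) p.418] -/
def qKnitOfRecord [Nonempty (Fin N)] : QFamY N θ := fun i => QknitY i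

/-- ★ **THE GENERIC ADJOINT FAMILY** of a letter family: `(i, U) ↦ adjTrY (𝔮 i U)`. [cite: Balaban1985BackgroundPropagators, (3.13) p.393, p.393 (scalar products)] -/
def qsOfQFamY (𝔮 : QFamY N θ) : QsFamY N θ := fun i U => adjTrY (𝔮 i U)

/-- ★ the knit family's adjoint family of record := its generic adjoint. [cite: Balaban1985BackgroundPropagators, (3.13) p.393] [cite: Balaban1985Averaging, (15) p.19] -/
def qsKnitOfRecord [Nonempty (Fin N)] : QsFamY N θ := qsOfQFamY N θ (qKnitOfRecord N θ)

variable {N θ}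

/-- `qYOfRecord`, evaluated (the v ≤ 9 letter, `rfl`). [cite: Balaban1985BackgroundPropagators, (3.12) p.393, bookkeeping] -/
theorem qYOfRecord_apply (i : KIdx θ.d₆ θ.ℓ₆ θ.hd' θ.hL' θ.b₀ θ.b₁) (U : CfgY (Matrix (Fin N) (Fin N) ℂ) i) :
    qYOfRecord N θ i U = QY i (parBY i) U := rfl

/-- `qsYOfRecord`, evaluated (`rfl`). [cite: Balaban1985BackgroundPropagators, (3.13) p.393, bookkeeping] -/
theorem qsYOfRecord_apply (i : KIdx θ.d₆ θ.ℓ₆ θ.hd' θ.hL' θ.b₀ θ.b₁) (U : CfgY (Matrix (Fin N) (Fin N) ℂ) i) :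
    qsYOfRecord N θ i U = QsY i (parBY i) U := rfl

/-- `qKnitOfRecord`, evaluated (`rfl`). [cite: Balaban1985Averaging, (15) p.19, bookkeeping] -/
theorem qKnitOfRecord_apply [Nonempty (Fin N)] (i : KIdx θ.d₆ θ.ℓ₆ θ.hd' θ.hL' θ.b₀ θ.b₁) (U : CfgY (Matrix (Fin N) (Fin N) ℂ) i) :
    qKnitOfRecord N θ i U = QknitY i U := rfl

/-- `qsKnitOfRecord`, evaluated (`rfl`). [cite: Balaban1985BackgroundPropagators, (3.13) p.393, bookkeeping] -/
theorem qsKnitOfRecord_apply [Nonempty (Fin N)] (i : KIdx θ.d₆ θ.ℓ₆ θ.hd' θ.hL' θ.b₀ θ.b₁) (U : CfgY (Matrix (Fin N) (Fin N) ℂ) i) :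
    qsKnitOfRecord N θ i U = adjTrY (QknitY i U) := rfl

/-- ★ (L1) indexwise for the straight-contour family of record. [cite: Balaban1985BackgroundPropagators, p.395 (Q(1) = Q)] -/
theorem isFlatQ_qYOfRecord (i : KIdx θ.d₆ θ.ℓ₆ θ.hd' θ.hL' θ.b₀ θ.b₁) : IsFlatQ (qYOfRecord N θ i) := isFlatQ_QY_parBY i

/-- ★ (L1) indexwise for the knit family of record. [cite: Balaban1985Averaging, (14)–(15) p.19] -/
theorem isFlatQ_qKnitOfRecord [Nonempty (Fin N)] (i : KIdx θ.d₆ θ.ℓ₆ θ.hd' θ.hL' θ.b₀ θ.b₁) : IsFlatQ (qKnitOfRecord N θ i) :=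
  isFlatQ_QknitY i

/-- ★ (L5) indexwise for the knit family of record (corner key). [cite: Balaban1985Averaging, (11) p.19] [cite: Balaban1985BackgroundPropagators, (3.32) pp.395–396] -/
theorem isCovCornerQ_qKnitOfRecord [Nonempty (Fin N)] (i : KIdx θ.d₆ θ.ℓ₆ θ.hd' θ.hL' θ.b₀ θ.b₁) : IsCovCornerQ (qKnitOfRecord N θ i) :=
  isCovCornerQ_QknitY i

/-- ★★ (L8) indexwise for the knit family of record on the regime of record (3.35) at `parKnitY`, by name (dag-n06-l).
[cite: Balaban1985BackgroundPropagators, (3.115) p.418, (3.35) p.396] [cite: Balaban1985Averaging, Prop. 2 p.26] -/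
theorem isNullOnQ_qKnitOfRecord [Nonempty (Fin N)] {G : Subgroup (Matrix (Fin N) (Fin N) ℂ)ˣ}
    (hG1 : ∀ u : (Matrix (Fin N) (Fin N) ℂ)ˣ, u ∈ G → ‖(u : Matrix (Fin N) (Fin N) ℂ)‖ ≤ 1) (hGU : G ≤ unitaryUnits (Matrix (Fin N) (Fin N) ℂ))
    {c₀ α₀ : ℝ} (hc : c₀ ≤ 10) (i : KIdx θ.d₆ θ.ℓ₆ θ.hd' θ.hL' θ.b₀ θ.b₁) (hMα : 0 ≤ (kGeo i).M * α₀) {α₀' : ℝ} (hα' : 0 < α₀')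
    (hα3 : C0 (θ.d₆ + 1) * α₀' ≤ 1 / 3) (hα2 : 2 * α₀' ≤ c2' (θ.d₆ + 1) (θ.ℓ₆ + 1)) (hK : Kpl i ((kGeo i).M * α₀) * (kGeo i).L ^ 4 < α₀') :
    IsNullOnQ (regQY G i c₀ α₀) (qKnitOfRecord N θ i) (parKnitY i) :=
  isNullOnQ_QknitY_reg335 i hG1 hGU hc hMα hα' hα3 hα2 hK

/-- ★ AT `U = 1` THE TWO FAMILIES OF RECORD AGREE (both are the flat averaging). [cite: Balaban1985Averaging, (14)–(15) p.19] [cite: Balaban1985BackgroundPropagators, p.395 (Q(1) = Q)] -/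
theorem qKnitOfRecord_one_eq [Nonempty (Fin N)] (i : KIdx θ.d₆ θ.ℓ₆ θ.hd' θ.hL' θ.b₀ θ.b₁) :
    qKnitOfRecord N θ i (fun _ _ => 1) = qYOfRecord N θ i (fun _ _ => 1) :=
  (isFlatQ_qKnitOfRecord i).trans (isFlatQ_qYOfRecord i).symm

/-- ★ (L3) indexwise for the pair of record on the regime of record, `G ≤ U(N)`. [cite: Balaban1985BackgroundPropagators, (3.13) p.393, (3.35) p.396] -/
theorem isAdjOnQ_qYOfRecord {G : Subgroup (Matrix (Fin N) (Fin N) ℂ)ˣ} (hG : G ≤ unitaryUnits (Matrix (Fin N) (Fin N) ℂ)) (c α₀ : ℝ)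
    (i : KIdx θ.d₆ θ.ℓ₆ θ.hd' θ.hL' θ.b₀ θ.b₁) : IsAdjOnQ (regQY G i c α₀) (qYOfRecord N θ i) (qsYOfRecord N θ i) :=
  isAdjOnQ_QY_QsY_parBY i hG c α₀

/-- ★ (L3) indexwise for the knit pair of record, on ANY regime (generic adjoint). [cite: Balaban1985BackgroundPropagators, (3.13) p.393, p.393 (scalar products)] -/
theorem isAdjOnQ_qKnitOfRecord [Nonempty (Fin N)] (i : KIdx θ.d₆ θ.ℓ₆ θ.hd' θ.hL' θ.b₀ θ.b₁) (𝓡 : RegimeY (Matrix (Fin N) (Fin N) ℂ) i) :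
    IsAdjOnQ 𝓡 (qKnitOfRecord N θ i) (qsKnitOfRecord N θ i) :=
  isAdjOnQ_adjTrY 𝓡 (qKnitOfRecord N θ i)

/-- ★ (L3) for ANY family with its generic adjoint family, on any regime. [cite: Balaban1985BackgroundPropagators, (3.13) p.393, p.393 (scalar products)] -/
theorem isAdjOnQ_qsOfQFamY (𝔮 : QFamY N θ) (i : KIdx θ.d₆ θ.ℓ₆ θ.hd' θ.hL' θ.b₀ θ.b₁) (𝓡 : RegimeY (Matrix (Fin N) (Fin N) ℂ) i) :
    IsAdjOnQ 𝓡 (𝔮 i) (qsOfQFamY N θ 𝔮 i) :=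
  isAdjOnQ_adjTrY 𝓡 (𝔮 i)

/-- ★ (L4) indexwise for the straight-contour family of record on the regime of record, `G ≤ U(N)`. [cite: Balaban1985BackgroundPropagators, p.391, (3.12) p.393] -/
theorem isRealOnQ_qYOfRecord {G : Subgroup (Matrix (Fin N) (Fin N) ℂ)ˣ} (hG : G ≤ unitaryUnits (Matrix (Fin N) (Fin N) ℂ)) (c α₀ : ℝ)
    (i : KIdx θ.d₆ θ.ℓ₆ θ.hd' θ.hL' θ.b₀ θ.b₁) : IsRealOnQ (regQY G i c α₀) (qYOfRecord N θ i) :=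
  isRealOnQ_QY_parBY i hG c α₀

/-- ★ (L4*) indexwise for the adjoint family of record on the regime of record, `G ≤ U(N)`. [cite: Balaban1985BackgroundPropagators, p.391, (3.13) p.393] -/
theorem isRealOnQs_qsYOfRecord {G : Subgroup (Matrix (Fin N) (Fin N) ℂ)ˣ} (hG : G ≤ unitaryUnits (Matrix (Fin N) (Fin N) ℂ)) (c α₀ : ℝ)
    (i : KIdx θ.d₆ θ.ℓ₆ θ.hd' θ.hL' θ.b₀ θ.b₁) : IsRealOnQs (regQY G i c α₀) (qsYOfRecord N θ i) :=
  isRealOnQs_QsY_parBY i hG c α₀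

/-- ★ (L4*) for a generic adjoint family from (L4) of the family. [cite: Balaban1985BackgroundPropagators, p.391, (3.13) p.393] -/
theorem isRealOnQs_qsOfQFamY {𝔮 : QFamY N θ} {i : KIdx θ.d₆ θ.ℓ₆ θ.hd' θ.hL' θ.b₀ θ.b₁} {𝓡 : RegimeY (Matrix (Fin N) (Fin N) ℂ) i}
    (h : IsRealOnQ 𝓡 (𝔮 i)) : IsRealOnQs 𝓡 (qsOfQFamY N θ 𝔮 i) :=
  h.adjTrY

/-- ★ (L6) indexwise for the straight-contour family of record, on any regime. [cite: Balaban1985BackgroundPropagators, (3.123)–(3.126) p.420] -/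
theorem isOntoOnQ_qYOfRecord (i : KIdx θ.d₆ θ.ℓ₆ θ.hd' θ.hL' θ.b₀ θ.b₁) (𝓡 : RegimeY (Matrix (Fin N) (Fin N) ℂ) i) :
    IsOntoOnQ 𝓡 (qYOfRecord N θ i) :=
  isOntoOnQ_QY i 𝓡 (parBY i)

/-- ★ (L7) with `K = 1` indexwise for the straight-contour family of record on the regime of record, `G` of unitary type.
[cite: Balaban1985BackgroundPropagators, (3.15) p.393] -/
theorem isBddOnQ_qYOfRecord [Nonempty (Fin N)] {G : Subgroup (Matrix (Fin N) (Fin N) ℂ)ˣ} (hG1 : G ≤ U1 (Matrix (Fin N) (Fin N) ℂ)) (c α₀ : ℝ)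
    (i : KIdx θ.d₆ θ.ℓ₆ θ.hd' θ.hL' θ.b₀ θ.b₁) : IsBddOnQ (regQY G i c α₀) (qYOfRecord N θ i) 1 :=
  isBddOnQ_QY_parBY i hG1 c α₀

end Record

end Literature.MathematicalPhysics.QuantumFieldTheory.Balaban1983to89.Node00.OpsYQLetter

end
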